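import Summits.Parity.GeneralizedHardyLittlewood.Theorems.BeyondDiagonalBeatsQuarter.OffDiagLevelFactorBox
import Summits.Parity.GeneralizedHardyLittlewood.Theorems.BeyondDiagonalBeatsQuarter.OffDiagCoreKernels
import HarnessLib

/-!
# Route `PrimeLevelFamEdge`, crux K_B (stmt-Parity-20343), line `diagonal_kernel_split` rev 4, plan Ω,
# node **L7d part 2, leaf S₅ — Taylor separation of the level factor INSIDE a `levelLargePart`, with the
# trivial-mass remainder** (L7D-PLAN rev 5 §5 (2); consumer of prover-8's `levelFactor_separation_box`)

Pointwise in the unit-box point (S₄), a member of the windowed FL-family enters through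
`levelLargePart R Q (q ↦ g(q)·Ψ_t(1/q)) n a`, `Ψ_t(v) = W(a(t)v)J₁(b(t)v)e(−κ(t)v)`. On a block of levels whose
reciprocals lie in `[t₀, t₀+ℓ] ⊆ [v₀, 2v₀]` with `ℓ ≤ ρ_min/2` (the member's Taylor radius, uniform on the box),
prover-8's `levelFactor_separation_box` applied to the finite level sum with weights `κ_q·g(q)`
(`κ_q = levelLargePart R {q} 1 n a`, `|κ_q| ≤ 1`) gives

  `‖levelLargePart R Q (g·Ψ_t(1/·)) n a − Σ_{j<J} C_j(t)·levelLargePart R Q (g·((1/q − t₀)/ℓ)^j) n a‖ ≤ J·2^{−J}·Σ_{q∈Q} ‖g q‖`,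
  `‖C_j(t)‖ ≤ 2^{−j}`

(**`levelLargePart_levelFactor_taylor`**): the universal level weights `g·((1/q − t₀)/ℓ)^j` no longer see the member,
the coefficients `C_j(t)` (member-dependent, `≤ 2^{−j}`) join the family weight, and the remainder is a trivial mass.

Helper; standard axioms; closes nothing. «The programme SEARCHES and TYPES; no claim about Landau–Siegel zeros,
Theorems 1–2 of arXiv:2211.02515 or a repaired Margin232 until a kernel theorem says so.»
-/

noncomputable section

open Finset Real Complex
open scoped Nat

namespace Summit.Parity.GeneralizedHardyLittlewood.Theorems.BeyondDiagonalBeatsQuarter.OffDiag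

open Literature.Analysis.FunctionSpaces (besselJ)
open Literature.NumberTheory.LFunctions.KMV2000 (cutoffW)
open LevelSeparation (levelFactor_separation_box)

/-- The singleton kernel `κ_q = levelLargePart R {q} 1 n a` has `‖κ_q‖ ≤ 1` (also for the degenerate modulus `n = 0`,
where it vanishes). [folklore] -/
theorem norm_levelLargePart_singleton_one_le (R q : ℕ) {n : ℕ} (a : ZMod n) :
    ‖levelLargePart R {q} (fun _ ↦ (1 : ℂ)) n a‖ ≤ 1 := by
  by_cases hn : n = 0
  · subst hn
    unfold levelLargePart
    rw [Nat.totient_zero, Nat.cast_zero, inv_zero, zero_mul, norm_zero]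
    exact zero_le_one
  · haveI : NeZero n := ⟨hn⟩
    exact (norm_kernels_le R a (q := q)).2.2

/-- **Taylor separation of the level factor inside a `levelLargePart`.** Data: `d₁, d₂ ≥ 1`, `α β c : ℕ`, box scales
`K₁, K₂ > 0`, phases `X₁ X₂`, a block `[t₀, t₀+ℓ] ⊆ [v₀, 2v₀]` of reciprocal levels with
`ℓ ≤ ρ_min/2 = v₀/(2(1 + 2b_max v₀ + 4πκ_max v₀))`, `J ≥ 1`, a box point `(t₁,t₂) ∈ [K₁/2,2K₁]×[K₂/2,2K₂]`, levels `Q`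
with `1/q ∈ [t₀, t₀+ℓ]`, any level weight `g`, `R`, class `a mod n`. Then
`‖LLP(g·Ψ_t(1/·)) − Σ_{j<J} C_j(t)·LLP(g·((1/q − t₀)/ℓ)^j)‖ ≤ J·2^{−J}·Σ_{q∈Q}‖g q‖` and `‖C_j(t)‖ ≤ 2^{−j}`.
[cite: KowalskiMichelVanderKam2000, §6 p. 19 — derivation] -/
theorem levelLargePart_levelFactor_taylor {d₁ d₂ : ℕ} (hd₁ : 1 ≤ d₁) (hd₂ : 1 ≤ d₂) (α β c : ℕ) {K₁ K₂ : ℝ}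
    (hK₁ : 0 < K₁) (hK₂ : 0 < K₂) (X₁ X₂ : ℝ) {v₀ t₀ ℓ : ℝ} (hv₀ : 0 < v₀) (hℓ : 0 < ℓ) (ht₀ : v₀ ≤ t₀)
    (ht₁ : t₀ + ℓ ≤ 2 * v₀)
    (hℓρ : ℓ ≤ v₀ / (1 + 2 * (4 * π * Real.sqrt ((α : ℝ) * β * (2 * K₁) * (2 * K₂)) / c) * v₀ +
      4 * π * (2 * K₁ * |X₁| + 2 * K₂ * |X₂|) * v₀) / 2)
    {J : ℕ} (hJ : 1 ≤ J) {t₁ t₂ : ℝ} (ht₁b : t₁ ∈ Set.Icc (K₁ / 2) (2 * K₁)) (ht₂b : t₂ ∈ Set.Icc (K₂ / 2) (2 * K₂))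
    (R : ℕ) (Q : Finset ℕ) (hQ : ∀ q ∈ Q, ((q : ℝ))⁻¹ ∈ Set.Icc t₀ (t₀ + ℓ)) (g : ℕ → ℂ) {n : ℕ} (a : ZMod n) :
    ‖levelLargePart R Q (fun q ↦ g q *
          ((cutoffW ((4 * π ^ 2 * ((d₁ : ℝ) * t₁ * ((d₂ : ℝ) * t₂))) * ((q : ℝ))⁻¹) : ℂ) *
            (besselJ 1 ((4 * π * Real.sqrt ((α : ℝ) * t₁ * ((β : ℝ) * t₂)) / c) * ((q : ℝ))⁻¹) : ℂ) *
              Complex.exp (((-2 * π * (t₁ * X₁ + t₂ * X₂) * ((q : ℝ))⁻¹ : ℝ) : ℂ) * I))) n a -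
        ∑ j ∈ Finset.range J,
          (((ℓ ^ j / j ! : ℝ) : ℂ) * iteratedDeriv j (fun v : ℝ =>
              (cutoffW ((4 * π ^ 2 * ((d₁ : ℝ) * t₁ * ((d₂ : ℝ) * t₂))) * v) : ℂ) *
                (besselJ 1 ((4 * π * Real.sqrt ((α : ℝ) * t₁ * ((β : ℝ) * t₂)) / c) * v) : ℂ) *
                  Complex.exp (((-2 * π * (t₁ * X₁ + t₂ * X₂) * v : ℝ) : ℂ) * I)) t₀) *
            levelLargePart R Q (fun q ↦ g q * ((((((q : ℝ))⁻¹ - t₀) / ℓ) ^ j : ℝ) : ℂ)) n a‖ ≤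
        J * (1 / 2) ^ J * ∑ q ∈ Q, ‖g q‖ ∧
      ∀ j : ℕ, ‖((ℓ ^ j / j ! : ℝ) : ℂ) * iteratedDeriv j (fun v : ℝ =>
          (cutoffW ((4 * π ^ 2 * ((d₁ : ℝ) * t₁ * ((d₂ : ℝ) * t₂))) * v) : ℂ) *
            (besselJ 1 ((4 * π * Real.sqrt ((α : ℝ) * t₁ * ((β : ℝ) * t₂)) / c) * v) : ℂ) *
              Complex.exp (((-2 * π * (t₁ * X₁ + t₂ * X₂) * v : ℝ) : ℂ) * I)) t₀‖ ≤ (1 / 2) ^ j := by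
  classical
  -- prover-8's separation with weights `κ_q·g q` and sample points `1/q`
  have hsep := levelFactor_separation_box hd₁ hd₂ α β c hK₁ hK₂ X₁ X₂ hv₀ hℓ ht₀ ht₁ hℓρ hJ ht₁b ht₂b Q
    (fun q ↦ levelLargePart R {q} (fun _ ↦ (1 : ℂ)) n a * g q) (fun q ↦ ((q : ℝ))⁻¹) hQ
  refine ⟨?_, hsep.2⟩
  -- singleton-kernel forms of the two `levelLargePart`s
  have hL : levelLargePart R Q (fun q ↦ g q *
      ((cutoffW ((4 * π ^ 2 * ((d₁ : ℝ) * t₁ * ((d₂ : ℝ) * t₂))) * ((q : ℝ))⁻¹) : ℂ) *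
        (besselJ 1 ((4 * π * Real.sqrt ((α : ℝ) * t₁ * ((β : ℝ) * t₂)) / c) * ((q : ℝ))⁻¹) : ℂ) *
          Complex.exp (((-2 * π * (t₁ * X₁ + t₂ * X₂) * ((q : ℝ))⁻¹ : ℝ) : ℂ) * I))) n a =
      ∑ q ∈ Q, (levelLargePart R {q} (fun _ ↦ (1 : ℂ)) n a * g q) *
        ((cutoffW ((4 * π ^ 2 * ((d₁ : ℝ) * t₁ * ((d₂ : ℝ) * t₂))) * ((q : ℝ))⁻¹) : ℂ) *
          (besselJ 1 ((4 * π * Real.sqrt ((α : ℝ) * t₁ * ((β : ℝ) * t₂)) / c) * ((q : ℝ))⁻¹) : ℂ) *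
            Complex.exp (((-2 * π * (t₁ * X₁ + t₂ * X₂) * ((q : ℝ))⁻¹ : ℝ) : ℂ) * I)) := by
    rw [← sum_levelLargePart_singleton_mul Q _ n R a]
    exact Finset.sum_congr rfl fun q _ ↦ by ring
  have hP : ∀ j : ℕ, levelLargePart R Q (fun q ↦ g q * ((((((q : ℝ))⁻¹ - t₀) / ℓ) ^ j : ℝ) : ℂ)) n a =
      ∑ q ∈ Q, (levelLargePart R {q} (fun _ ↦ (1 : ℂ)) n a * g q) * ((((((q : ℝ))⁻¹ - t₀) / ℓ) ^ j : ℝ) : ℂ) := by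
    intro j
    rw [← sum_levelLargePart_singleton_mul Q _ n R a]
    exact Finset.sum_congr rfl fun q _ ↦ by ring
  rw [hL]
  simp only [hP]
  refine hsep.1.trans ?_
  have hκ : ∑ q ∈ Q, ‖levelLargePart R {q} (fun _ ↦ (1 : ℂ)) n a * g q‖ ≤ ∑ q ∈ Q, ‖g q‖ := by
    refine Finset.sum_le_sum fun q _ ↦ ?_
    rw [norm_mul]
    calc _ ≤ 1 * ‖g q‖ := mul_le_mul_of_nonneg_right (norm_levelLargePart_singleton_one_le R q a) (norm_nonneg _)
      _ = ‖g q‖ := one_mul _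
  exact mul_le_mul_of_nonneg_left hκ (by positivity)

end Summit.Parity.GeneralizedHardyLittlewood.Theorems.BeyondDiagonalBeatsQuarter.OffDiag
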